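import Summits.QuantumAdvantage.QuantumAdvantage.Theorems.AnchorDialSetWindow

/-!
# AnchorDial — part 19 «CoreF» (cell decomp-qadv, seat lens-2, generation 15; supports item 26531 `ExactnessDial.PolyLossOddU3`)

§A of the g15 node «GaugeDial»: the GENERAL `F`-FLIP CORE.  Sign patterns `σ ∈ {0,1}^F`, orbit lines
`lvF σ τ ε = τ + Σ_i ct(ε_i, σ_i)`, `AvoidsF a σ τ` (the line through `τ` misses the table `a` at every one of the `2^F`
orbit points), `CompatF`, the Hamming distance `hdF`; `no_thirdF` (two compatible patterns at distance `≥ 3` exclude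
every third one — by restriction `res`/`emb` to four coordinates and part 1's kernel-decided `Core.no_third`), the
radius-2 ball bound `card_ball_le` (`≤ 1 + F + C(F,2)` by injecting into subsets of size `≤ 2`), the core bound
`card_compatF_le`, its union form `card_exists_avoidsF_le` over a finite family of tables, and the numerics
`two_anchor_numerics : 6²·(1+12+C(12,2)) < 2^12`.  Pure combinatorics over `Fin F → Bool` / `ZMod 3`; namespace
`…Theorems.AnchorDial.CoreF`; imports part 18 (for the linear part chain; uses only part 1 `Core`).  Verbatim from the
node file HOME/decomp-qadv-lens-2/g15/GaugeDial.lean §A; no `sorry`, no `native_decide`, no instances/notation.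
-/

set_option linter.dupNamespace false
set_option linter.unusedVariables false

/-! ## §A  The F-flip CORE (general `F ≥ 4`): sign patterns `σ ∈ {0,1}^F`, orbit lines
`ℓ_{σ,τ}(ε) = τ + Σ_i [ε_i]·(1+[σ_i])` over `𝔽₃`, `no_thirdF` (by restriction to four coordinates and
`Core.no_third`), the radius-2 ball bound, `card_compatF_le` (≤ `1 + F + C(F,2)` of the `2^F` sign vectors are
compatible with ANY avoid-value table) and the GAUGE UNION BOUND `card_exists_avoidsF_le`
(≤ `|G|·(1 + F + C(F,2))` sign vectors are compatible with some table of a `G`-indexed family). -/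

namespace Summit.QuantumAdvantage.QuantumAdvantage.Theorems.AnchorDial.CoreF

open Finset

variable {F : ℕ}

/-- the ORBIT LINE of the hidden trit `τ` under `F` commuting far pair-flips with sign vector `σ`, read at the
orbit point `ε ∈ {0,1}^F`: `τ + Σ_i [ε_i]·σ_i` (`σ_i ∈ {1,2}` coded by a bit, `Core.ct`). -/
def lvF (σ : Fin F → Bool) (τ : ZMod 3) (ε : Fin F → Bool) : ZMod 3 := τ + ∑ i, Core.ct (ε i) (σ i)

/-- the table `a` AVOIDS the line `(σ, τ)`: `a(ε) ≠ ℓ_{σ,τ}(ε)` at every orbit point. -/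
def AvoidsF (a : (Fin F → Bool) → ZMod 3) (σ : Fin F → Bool) (τ : ZMod 3) : Prop := ∀ ε, a ε ≠ lvF σ τ ε

/-- `σ` is COMPATIBLE with the table `a`: some hidden trit makes `a` avoid its line. -/
def CompatF (a : (Fin F → Bool) → ZMod 3) (σ : Fin F → Bool) : Prop := ∃ τ, AvoidsF a σ τ

/-- Hamming distance on `{0,1}^F`. -/
def hdF (σ σ' : Fin F → Bool) : ℕ := (univ.filter fun i => σ i ≠ σ' i).card

/-- the four-coordinate orbit points: `ε ∈ {0,1}^4` placed at `i₁, i₂, i₃, i₄`, zero elsewhere. -/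
def emb (i₁ i₂ i₃ i₄ : Fin F) (ε : Core.B4) : Fin F → Bool := fun i =>
  if i = i₁ then ε.1 else if i = i₂ then ε.2.1 else if i = i₃ then ε.2.2.1 else if i = i₄ then ε.2.2.2 else false

/-- restriction of a sign vector to four coordinates. -/
def res (i₁ i₂ i₃ i₄ : Fin F) (σ : Fin F → Bool) : Core.B4 := (σ i₁, σ i₂, σ i₃, σ i₄)

/-- restriction to four distinct coordinates turns `F`-lines into `Core.lv` lines. -/
theorem lvF_emb {i₁ i₂ i₃ i₄ : Fin F} (h12 : i₁ ≠ i₂) (h13 : i₁ ≠ i₃) (h14 : i₁ ≠ i₄) (h23 : i₂ ≠ i₃)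
    (h24 : i₂ ≠ i₄) (h34 : i₃ ≠ i₄) (σ : Fin F → Bool) (τ : ZMod 3) (ε : Core.B4) :
    lvF σ τ (emb i₁ i₂ i₃ i₄ ε) = Core.lv (res i₁ i₂ i₃ i₄ σ) τ ε := by
  obtain ⟨e₁, e₂, e₃, e₄⟩ := ε
  set f : Fin F → ZMod 3 := fun i => Core.ct (emb i₁ i₂ i₃ i₄ (e₁, e₂, e₃, e₄) i) (σ i) with hf
  have h1 : f i₁ = Core.ct e₁ (σ i₁) := by simp [hf, emb]
  have h2 : f i₂ = Core.ct e₂ (σ i₂) := by simp [hf, emb, h12.symm]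
  have h3 : f i₃ = Core.ct e₃ (σ i₃) := by simp [hf, emb, h13.symm, h23.symm]
  have h4 : f i₄ = Core.ct e₄ (σ i₄) := by simp [hf, emb, h14.symm, h24.symm, h34.symm]
  have hrest : ∀ i, i ≠ i₁ → i ≠ i₂ → i ≠ i₃ → i ≠ i₄ → f i = 0 := by
    intro i n1 n2 n3 n4
    simp [hf, emb, n1, n2, n3, n4, Core.ct]
  have hz : ∑ i ∈ (((univ.erase i₁).erase i₂).erase i₃).erase i₄, f i = 0 := sum_eq_zero fun i hi => by
    simp only [mem_erase, mem_univ, and_true] at hi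
    exact hrest i hi.2.2.2 hi.2.2.1 hi.2.1 hi.1
  have S : ∑ i, f i = f i₁ + (f i₂ + (f i₃ + (f i₄ + ∑ i ∈ (((univ.erase i₁).erase i₂).erase i₃).erase i₄, f i))) := by
    rw [add_sum_erase _ f (show i₄ ∈ ((univ.erase i₁).erase i₂).erase i₃ by simp [h34.symm, h24.symm, h14.symm]),
      add_sum_erase _ f (show i₃ ∈ (univ.erase i₁).erase i₂ by simp [h23.symm, h13.symm]),
      add_sum_erase _ f (show i₂ ∈ univ.erase i₁ by simp [h12.symm]), add_sum_erase _ f (mem_univ i₁)]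
  show τ + ∑ i, f i = _
  rw [S, hz, h1, h2, h3, h4]
  unfold Core.lv res
  ring

/-- AvoidsF restricts to `Core.Avoids` on any four distinct coordinates. -/
theorem avoids_res {a : (Fin F → Bool) → ZMod 3} {σ : Fin F → Bool} {τ : ZMod 3} {i₁ i₂ i₃ i₄ : Fin F}
    (h12 : i₁ ≠ i₂) (h13 : i₁ ≠ i₃) (h14 : i₁ ≠ i₄) (h23 : i₂ ≠ i₃) (h24 : i₂ ≠ i₄) (h34 : i₃ ≠ i₄)
    (h : AvoidsF a σ τ) : Core.Avoids (fun ε => a (emb i₁ i₂ i₃ i₄ ε)) (res i₁ i₂ i₃ i₄ σ) τ := by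
  intro ε
  rw [← lvF_emb h12 h13 h14 h23 h24 h34 σ τ ε]
  exact h _

/-- AnchorDial CoreF helper: three differing coordinates give `Core.hd ≥ 3`. -/
theorem hd_three : ∀ a b c d a' b' c' d' : Bool, a ≠ a' → b ≠ b' → c ≠ c' →
    3 ≤ Core.hd (a, b, c, d) (a', b', c', d') := by decide

/-- **no third line** (general `F ≥ 4`): a table avoiding two lines at Hamming distance `≥ 3` avoids no third. -/
theorem no_thirdF (hF : 4 ≤ F) {a : (Fin F → Bool) → ZMod 3} {σ₁ σ₂ σ₃ : Fin F → Bool} {τ₁ τ₂ τ₃ : ZMod 3}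
    (h₁ : AvoidsF a σ₁ τ₁) (h₂ : AvoidsF a σ₂ τ₂) (h₃ : AvoidsF a σ₃ τ₃) (hfar : 3 ≤ hdF σ₁ σ₂) :
    σ₃ = σ₁ ∨ σ₃ = σ₂ := by
  by_contra hne
  push Not at hne
  obtain ⟨j₁, j₂, j₃, hj₁, hj₂, hj₃, n12, n13, n23⟩ := two_lt_card_iff.1 (show 2 < hdF σ₁ σ₂ from hfar)
  rw [mem_filter] at hj₁ hj₂ hj₃
  -- the restriction argument at a fourth coordinate `j₄`
  have key : ∀ j₄, j₁ ≠ j₄ → j₂ ≠ j₄ → j₃ ≠ j₄ → res j₁ j₂ j₃ j₄ σ₃ ≠ res j₁ j₂ j₃ j₄ σ₁ →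
      res j₁ j₂ j₃ j₄ σ₃ ≠ res j₁ j₂ j₃ j₄ σ₂ → False := by
    intro j₄ n14 n24 n34 hne1 hne2
    have hd3 : 3 ≤ Core.hd (res j₁ j₂ j₃ j₄ σ₁) (res j₁ j₂ j₃ j₄ σ₂) :=
      hd_three _ _ _ _ _ _ _ _ hj₁.2 hj₂.2 hj₃.2
    rcases Core.no_third (avoids_res n12 n13 n14 n23 n24 n34 h₁) (avoids_res n12 n13 n14 n23 n24 n34 h₂)
      (avoids_res n12 n13 n14 n23 n24 n34 h₃) hd3 with e | e
    · exact hne1 e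
    · exact hne2 e
  by_cases hB : σ₃ j₁ = σ₁ j₁ ∧ σ₃ j₂ = σ₁ j₂ ∧ σ₃ j₃ = σ₁ j₃
  · obtain ⟨j₄, hj₄⟩ := Function.ne_iff.1 hne.1
    refine key j₄ (fun h => hj₄ (h ▸ hB.1)) (fun h => hj₄ (h ▸ hB.2.1)) (fun h => hj₄ (h ▸ hB.2.2))
      (fun h => hj₄ (congrArg (fun t : Core.B4 => t.2.2.2) h)) (fun h => hj₁.2 ?_)
    rw [← hB.1]
    exact congrArg (fun t : Core.B4 => t.1) h
  by_cases hC : σ₃ j₁ = σ₂ j₁ ∧ σ₃ j₂ = σ₂ j₂ ∧ σ₃ j₃ = σ₂ j₃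
  · obtain ⟨j₄, hj₄⟩ := Function.ne_iff.1 hne.2
    refine key j₄ (fun h => hj₄ (h ▸ hC.1)) (fun h => hj₄ (h ▸ hC.2.1)) (fun h => hj₄ (h ▸ hC.2.2))
      (fun h => hj₁.2 ?_) (fun h => hj₄ (congrArg (fun t : Core.B4 => t.2.2.2) h))
    rw [← hC.1]
    exact (congrArg (fun t : Core.B4 => t.1) h).symm
  -- generic case: any fourth coordinate works; one exists since `F ≥ 4`
  have hex : ∃ j₄ : Fin F, j₄ ∉ ({j₁, j₂, j₃} : Finset (Fin F)) := by
    by_contra hall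
    push Not at hall
    have hsub : (univ : Finset (Fin F)) ⊆ {j₁, j₂, j₃} := fun j _ => hall j
    have h := card_le_card hsub
    rw [card_univ, Fintype.card_fin] at h
    have h3 : ({j₁, j₂, j₃} : Finset (Fin F)).card ≤ 3 :=
      (card_insert_le _ _).trans (Nat.succ_le_succ ((card_insert_le _ _).trans (by simp)))
    omega
  obtain ⟨j₄, hj₄⟩ := hex
  simp only [mem_insert, mem_singleton, not_or] at hj₄
  refine key j₄ (Ne.symm hj₄.1) (Ne.symm hj₄.2.1) (Ne.symm hj₄.2.2) (fun h => hB ?_) (fun h => hC ?_)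
  · exact ⟨congrArg (fun t : Core.B4 => t.1) h, congrArg (fun t : Core.B4 => t.2.1) h,
      congrArg (fun t : Core.B4 => t.2.2.1) h⟩
  · exact ⟨congrArg (fun t : Core.B4 => t.1) h, congrArg (fun t : Core.B4 => t.2.1) h,
      congrArg (fun t : Core.B4 => t.2.2.1) h⟩

/-- AnchorDial CoreF helper (a bit is determined by whether it differs from a reference bit). -/
theorem bool_eq_of_ne_iff : ∀ s r r' : Bool, ((s ≠ r) ↔ (s ≠ r')) → r = r' := by decide

/-- the RADIUS-2 BALL BOUND: at most `1 + F + C(F,2)` sign vectors lie within Hamming distance `2` of `σ₀`. -/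
theorem card_ball_le (σ₀ : Fin F → Bool) :
    (univ.filter fun ρ : Fin F → Bool => hdF σ₀ ρ ≤ 2).card ≤ 1 + F + F.choose 2 := by
  set T : Finset (Finset (Fin F)) := powersetCard 0 univ ∪ powersetCard 1 univ ∪ powersetCard 2 univ with hT
  have hT_card : T.card ≤ 1 + F + F.choose 2 := by
    refine (card_union_le _ _).trans ?_
    have h01 := card_union_le (powersetCard 0 (univ : Finset (Fin F))) (powersetCard 1 univ)
    rw [card_powersetCard, card_powersetCard, card_univ, Fintype.card_fin, Nat.choose_zero_right,
      Nat.choose_one_right] at h01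
    rw [card_powersetCard, card_univ, Fintype.card_fin]
    omega
  refine le_trans ?_ hT_card
  refine card_le_card_of_injOn (fun ρ => univ.filter fun i => σ₀ i ≠ ρ i) (fun ρ hρ => ?_) ?_
  · rw [mem_coe, mem_filter] at hρ
    have h2 : (univ.filter fun i => σ₀ i ≠ ρ i).card ≤ 2 := hρ.2
    dsimp only
    rw [hT, mem_coe, mem_union, mem_union, mem_powersetCard, mem_powersetCard, mem_powersetCard]
    rcases Nat.lt_or_ge (univ.filter fun i => σ₀ i ≠ ρ i).card 1 with h | h
    · exact Or.inl (Or.inl ⟨subset_univ _, by omega⟩)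
    rcases Nat.lt_or_ge (univ.filter fun i => σ₀ i ≠ ρ i).card 2 with h' | h'
    · exact Or.inl (Or.inr ⟨subset_univ _, by omega⟩)
    · exact Or.inr ⟨subset_univ _, by omega⟩
  · intro ρ _ ρ' _ h
    funext i
    have hi := Finset.ext_iff.1 h i
    simp only [mem_filter, mem_univ, true_and] at hi
    exact bool_eq_of_ne_iff _ _ _ hi

open scoped Classical in
/-- **CORE (general `F ≥ 4`): at most `1 + F + C(F,2)` of the `2^F` sign vectors are compatible with any table.** -/
theorem card_compatF_le (hF : 4 ≤ F) (a : (Fin F → Bool) → ZMod 3) :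
    (univ.filter fun σ => CompatF a σ).card ≤ 1 + F + F.choose 2 := by
  set S := univ.filter fun σ => CompatF a σ with hS
  by_cases hfar : ∃ σ ∈ S, ∃ σ' ∈ S, 3 ≤ hdF σ σ'
  · obtain ⟨σ, hσ, σ', hσ', h3⟩ := hfar
    obtain ⟨τ, hτ⟩ := (mem_filter.1 hσ).2
    obtain ⟨τ', hτ'⟩ := (mem_filter.1 hσ').2
    have hsub : S ⊆ {σ, σ'} := by
      intro ρ hρ
      obtain ⟨τρ, hρ'⟩ := (mem_filter.1 hρ).2
      rcases no_thirdF hF hτ hτ' hρ' h3 with h | h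
      · rw [h]; exact mem_insert_self _ _
      · rw [h]; exact mem_insert_of_mem (mem_singleton_self _)
    refine (card_le_card hsub).trans ((card_insert_le _ _).trans ?_)
    rw [card_singleton]
    omega
  · push Not at hfar
    rcases S.eq_empty_or_nonempty with h0 | ⟨σ₀, h₀⟩
    · rw [h0, card_empty]; omega
    · refine le_trans (card_le_card fun ρ hρ => ?_) (card_ball_le σ₀)
      rw [mem_filter]
      exact ⟨mem_univ _, Nat.le_of_lt_succ (hfar σ₀ h₀ ρ hρ)⟩

open scoped Classical in
/-- **GAUGE UNION BOUND**: for a `G`-indexed family of tables, at most `|G|·(1 + F + C(F,2))` sign vectors make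
SOME member avoid their line through `τ = 0`. (`|G| = 6^m` hidden gauges of `m` anchors; `< 2^F` for `F` large.) -/
theorem card_exists_avoidsF_le {G : Type*} [Fintype G] (hF : 4 ≤ F) (tab : G → (Fin F → Bool) → ZMod 3) :
    (univ.filter fun σ : Fin F → Bool => ∃ g, AvoidsF (tab g) σ 0).card ≤
      Fintype.card G * (1 + F + F.choose 2) := by
  calc (univ.filter fun σ : Fin F → Bool => ∃ g, AvoidsF (tab g) σ 0).card
      ≤ (univ.biUnion fun g : G => univ.filter fun σ : Fin F → Bool => CompatF (tab g) σ).card := by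
        refine card_le_card fun σ hσ => ?_
        rw [mem_filter] at hσ
        obtain ⟨g, hg⟩ := hσ.2
        rw [mem_biUnion]
        exact ⟨g, mem_univ _, mem_filter.2 ⟨mem_univ _, 0, hg⟩⟩
    _ ≤ ∑ g : G, (univ.filter fun σ : Fin F → Bool => CompatF (tab g) σ).card := card_biUnion_le
    _ ≤ ∑ g : G, (1 + F + F.choose 2) := sum_le_sum fun g _ => card_compatF_le hF (tab g)
    _ = Fintype.card G * (1 + F + F.choose 2) := by rw [sum_const, card_univ, smul_eq_mul]

/-- numerics of the two-anchor instance: `6^2 · (1 + 12 + 66) = 2844 < 4096 = 2^12` (twelve flips suffice for two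
anchors with the ball bound; nine with the Kleitman bound `F + 1`). -/
theorem two_anchor_numerics : 6 ^ 2 * (1 + 12 + Nat.choose 12 2) < 2 ^ 12 := by decide

end Summit.QuantumAdvantage.QuantumAdvantage.Theorems.AnchorDial.CoreF
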